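import Mathlib

/-!
# SoloBlind — graded filling: the linear algebra behind Theorem 18 (anchor of LieExponent §3.32)

Setting (pen side, `paper/LieExponent.md` §3.31–3.32): `(S; H₂, H₃)` a TPP triple in `GL_n(ℝ)`, `H₂, H₃`
connected Lie subgroups with `𝔥₂ ∩ 𝔥₃ = 0`, `U₀ = 𝔥₂ ⊕ 𝔥₃` of codimension `m`, `Π = U₀^⊥` for the trace form,
`β(𝔥₂,𝔥₃)` the co-closing number (largest dimension of a PAIR-SPLIT subalgebra `𝔟 = (𝔟 ∩ 𝔥₂) ⊕ (𝔟 ∩ 𝔥₃)`), and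
Theorem 17(i): `d₁ ≤ d − q − β`.  Theorem 18: a normalising element `y ∈ 𝔥_j ∩ 𝔫(𝔥_k)` grades everything by the
real parts of the eigenvalues of `ad y`; if `Π` lies on one side of the grading, the nilpotent part `N_ε` lies in
`U₀`, splits along the pair, and `𝔠 ⊕ N_ε` is pair-split for every pair-split `𝔠` of the degree-zero pair, so
`β ≥ β(𝔥₂⁽⁰⁾, 𝔥₃⁽⁰⁾) + dim N_ε`.  The Lie-theoretic inputs (primary decomposition of `ad y`, invariance of the
trace form, `[𝔤⁽ʳ⁾, 𝔤⁽ˢ⁾] ⊆ 𝔤⁽ʳ⁺ˢ⁾`) stay on the pen side; checked here are the three linear-algebra steps and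
the arithmetic:

* `soloLie_aeval_stable` — a subspace stable under `T` is stable under every polynomial in `T` (so every
  `ad y`-stable subspace is stable under the spectral projections of `ad y`);
* `soloLie_graded_piece` — if an idempotent `p` preserves `H₂` and `H₃` then
  `(H₂ ⊔ H₃) ⊓ range p = (H₂ ⊓ range p) ⊔ (H₃ ⊓ range p)` (the graded pieces of `U₀ = 𝔥₂ ⊕ 𝔥₃` split:
  `U₀⁽ʳ⁾ = 𝔥₂⁽ʳ⁾ ⊕ 𝔥₃⁽ʳ⁾`, Theorem 18(i));
* `soloLie_pairSplit_sup` — pair-splitness propagates from `C` and `N` (with `C ⊓ N = ⊥`, `H₂ ⊓ H₃ = ⊥`) to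
  `C ⊔ N`, with `dim (C ⊔ N) = dim C + dim N` (Theorem 18(ii));
* `soloLie_graded_filling_deficit` — the bookkeeping `d₁ + q + β ≤ d`, `β ≥ z + h_k⁽⁰⁾ + dim N_ε` ⟹
  `d₁ + q ≤ N_G + m` as soon as `z + h_k⁽⁰⁾ + dim N_ε + m ≥ N_G + ι` (`d = 2 N_G + ι`), and the GL₆ instance of
  Corollary 18.1 (`d = 36`, `β ≥ 20`, `q ≥ 1` ⟹ `d₁ ≤ 15`).
-/

set_option linter.dupNamespace false

namespace Summit.MatrixMultiplication.MatrixMultiplication.Theorems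

open Module

section Stable

variable {K V : Type*} [Field K] [AddCommGroup V] [Module K V]

/-- A `T`-stable subspace is stable under `T ^ n`. -/
theorem soloLie_pow_stable (T : Module.End K V) (H : Submodule K V) (hT : ∀ x ∈ H, T x ∈ H) :
    ∀ n : ℕ, ∀ x ∈ H, (T ^ n) x ∈ H := by
  intro n
  induction n with
  | zero => intro x hx; simpa using hx
  | succ n ih =>
      intro x hx
      rw [pow_succ', Module.End.mul_apply]
      exact hT _ (ih x hx)

/-- A `T`-stable subspace is stable under every polynomial in `T`; in Theorem 18 this makes every `ad y`-stable
subspace (`𝔥₂`, `𝔥₃`, `U₀`, `Π`) stable under the spectral projections of `ad y`, i.e. GRADED. -/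
theorem soloLie_aeval_stable (T : Module.End K V) (H : Submodule K V) (hT : ∀ x ∈ H, T x ∈ H)
    (f : Polynomial K) : ∀ x ∈ H, Polynomial.aeval T f x ∈ H := by
  induction f using Polynomial.induction_on' with
  | add p q hp hq =>
      intro x hx
      rw [map_add, LinearMap.add_apply]
      exact H.add_mem (hp x hx) (hq x hx)
  | monomial n a =>
      intro x hx
      rw [Polynomial.aeval_monomial, Module.End.mul_apply, Module.algebraMap_end_apply]
      exact H.smul_mem a (soloLie_pow_stable T H hT n x hx)

/-- GRADED PIECES SPLIT (Theorem 18(i)).  If an idempotent endomorphism `p` (a spectral projection of `ad y`)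
preserves `H₂` and `H₃`, then the `p`-component of `U₀ = H₂ + H₃` is the sum of the `p`-components of the members:
`(H₂ ⊔ H₃) ⊓ range p = (H₂ ⊓ range p) ⊔ (H₃ ⊓ range p)`. -/
theorem soloLie_graded_piece (p : Module.End K V) (hp : ∀ x, p (p x) = p x) (H₂ H₃ : Submodule K V)
    (h₂ : ∀ x ∈ H₂, p x ∈ H₂) (h₃ : ∀ x ∈ H₃, p x ∈ H₃) :
    (H₂ ⊔ H₃) ⊓ LinearMap.range p = (H₂ ⊓ LinearMap.range p) ⊔ (H₃ ⊓ LinearMap.range p) := by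
  apply le_antisymm
  · intro x hx
    obtain ⟨hx1, hx2⟩ := Submodule.mem_inf.1 hx
    obtain ⟨a, ha, b, hb, rfl⟩ := Submodule.mem_sup.1 hx1
    obtain ⟨v, hv⟩ := LinearMap.mem_range.1 hx2
    have hfix : p (a + b) = a + b := by rw [← hv, hp]
    rw [← hfix, map_add]
    refine Submodule.add_mem_sup ?_ ?_
    · exact Submodule.mem_inf.2 ⟨h₂ a ha, LinearMap.mem_range.2 ⟨a, rfl⟩⟩
    · exact Submodule.mem_inf.2 ⟨h₃ b hb, LinearMap.mem_range.2 ⟨b, rfl⟩⟩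
  · exact sup_le (inf_le_inf_right _ le_sup_left) (inf_le_inf_right _ le_sup_right)

end Stable

section PairSplit

variable {K V : Type*} [DivisionRing K] [AddCommGroup V] [Module K V] [FiniteDimensional K V]

/-- Two subspaces meeting trivially have additive dimension. -/
theorem soloLie_finrank_sup_of_disjoint (A B : Submodule K V) (h : A ⊓ B = ⊥) :
    finrank K ↥(A ⊔ B) = finrank K A + finrank K B := by
  have e := Submodule.finrank_sup_add_finrank_inf_eq A B
  rw [h, finrank_bot, add_zero] at e
  exact e

/-- PAIR-SPLITNESS PROPAGATES (Theorem 18(ii)).  `H₂ ⊓ H₃ = ⊥` (the pair), `C ⊓ N = ⊥` (degree zero versus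
non-zero degrees), `C` pair-split (`dim (C ⊓ H₂) + dim (C ⊓ H₃) = dim C`) and `N` pair-split; then `C ⊔ N` is
pair-split and `dim (C ⊔ N) = dim C + dim N`.  With `C = 𝔠` a pair-split subalgebra of the degree-zero pair and
`N = N_ε = 𝔥₂^{(ε>0)} ⊕ 𝔥₃^{(ε>0)}` this is `β(𝔥₂,𝔥₃) ≥ dim 𝔠 + dim N_ε`. -/
theorem soloLie_pairSplit_sup (H₂ H₃ C N : Submodule K V) (hH : H₂ ⊓ H₃ = ⊥) (hCN : C ⊓ N = ⊥)
    (hC : finrank K ↥(C ⊓ H₂) + finrank K ↥(C ⊓ H₃) = finrank K C)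
    (hN : finrank K ↥(N ⊓ H₂) + finrank K ↥(N ⊓ H₃) = finrank K N) :
    finrank K ↥((C ⊔ N) ⊓ H₂) + finrank K ↥((C ⊔ N) ⊓ H₃) = finrank K ↥(C ⊔ N) ∧
      finrank K ↥(C ⊔ N) = finrank K C + finrank K N := by
  -- the candidate pieces A₂ = C₂ + N₂ and A₃ = C₃ + N₃
  have hA2 : finrank K ↥(C ⊓ H₂ ⊔ N ⊓ H₂) = finrank K ↥(C ⊓ H₂) + finrank K ↥(N ⊓ H₂) := by
    apply soloLie_finrank_sup_of_disjoint
    apply le_antisymm _ bot_le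
    calc C ⊓ H₂ ⊓ (N ⊓ H₂) ≤ C ⊓ N := le_inf (le_trans inf_le_left inf_le_left) (le_trans inf_le_right inf_le_left)
      _ = ⊥ := hCN
  have hA3 : finrank K ↥(C ⊓ H₃ ⊔ N ⊓ H₃) = finrank K ↥(C ⊓ H₃) + finrank K ↥(N ⊓ H₃) := by
    apply soloLie_finrank_sup_of_disjoint
    apply le_antisymm _ bot_le
    calc C ⊓ H₃ ⊓ (N ⊓ H₃) ≤ C ⊓ N := le_inf (le_trans inf_le_left inf_le_left) (le_trans inf_le_right inf_le_left)
      _ = ⊥ := hCN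
  have hle2 : C ⊓ H₂ ⊔ N ⊓ H₂ ≤ (C ⊔ N) ⊓ H₂ :=
    sup_le (inf_le_inf_right _ le_sup_left) (inf_le_inf_right _ le_sup_right)
  have hle3 : C ⊓ H₃ ⊔ N ⊓ H₃ ≤ (C ⊔ N) ⊓ H₃ :=
    sup_le (inf_le_inf_right _ le_sup_left) (inf_le_inf_right _ le_sup_right)
  have m2 := Submodule.finrank_mono hle2
  have m3 := Submodule.finrank_mono hle3
  -- the actual pieces meet trivially and sit inside C ⊔ N
  have hB : finrank K ↥((C ⊔ N) ⊓ H₂ ⊔ (C ⊔ N) ⊓ H₃) =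
      finrank K ↥((C ⊔ N) ⊓ H₂) + finrank K ↥((C ⊔ N) ⊓ H₃) := by
    apply soloLie_finrank_sup_of_disjoint
    apply le_antisymm _ bot_le
    calc (C ⊔ N) ⊓ H₂ ⊓ ((C ⊔ N) ⊓ H₃) ≤ H₂ ⊓ H₃ := le_inf (le_trans inf_le_left inf_le_right)
            (le_trans inf_le_right inf_le_right)
      _ = ⊥ := hH
  have hBle : (C ⊔ N) ⊓ H₂ ⊔ (C ⊔ N) ⊓ H₃ ≤ C ⊔ N := sup_le inf_le_left inf_le_left
  have mB := Submodule.finrank_mono hBle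
  have hCNsum : finrank K ↥(C ⊔ N) = finrank K C + finrank K N :=
    soloLie_finrank_sup_of_disjoint C N hCN
  refine ⟨?_, hCNsum⟩
  omega

end PairSplit

section Bookkeeping

/-- THEOREM 18(iii) BOOKKEEPING.  Theorem 17(i) `d₁ + q + β ≤ d`; the graded filling `β ≥ z + h_k⁽⁰⁾ + n_ε`
(`z = dim 𝔷 ≥ 1`, `n_ε = dim N_ε`); `d = 2 N_G + ι`.  Then `d₁ + q + z + h_k⁽⁰⁾ + n_ε ≤ d`, and the saturation
criterion: `z + h_k⁽⁰⁾ + n_ε + m ≥ N_G + ι` gives `d₁ + q ≤ N_G + m`, i.e. conjecture (S₂) for the pair. -/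
theorem soloLie_graded_filling_deficit (d d₁ q β z hk0 nε N ι m : ℕ)
    (h17 : d₁ + q + β ≤ d) (hβ : z + hk0 + nε ≤ β) (hd : d = 2 * N + ι) :
    d₁ + q + z + hk0 + nε ≤ d ∧ (N + ι ≤ z + hk0 + nε + m → d₁ + q ≤ N + m) := by
  refine ⟨by omega, fun h => by omega⟩

/-- COROLLARY 18.1 (the GL₆ format of Prop. 17.8(e)): `d = 36`, the graded filling exhibits a pair-split subalgebra
of dimension `2 + 6 + 12 = 20` (`𝔷⁰ ⊕ 𝔥₃⁽⁰⁾ ⊕ N₋`), the third member is pinned (`q ≥ 1`); hence `d₁ ≤ 15`,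
one below the subgroup optimum `N_G + m − 1 = 16`. -/
theorem soloLie_gl6_format_dead (d₁ q β : ℕ) (h17 : d₁ + q + β ≤ 36) (hβ : 2 + 6 + 12 ≤ β) (hq : 1 ≤ q) :
    d₁ ≤ 15 := by
  omega

/-- LEMMA 3.14 versus THEOREM 18 on the GL₆ pair: the normalising line alone (`β ≥ 1 + h₃ = 18`) gives only
`d₁ ≤ 17 = N_G + m`; degree zero with `𝔷 = ℝ y` (`β ≥ 1 + 6 + 12 = 19`) gives `16 = N_G + m − 1`; the central
2-plane `𝔷⁰` (`β ≥ 20`) gives `15`. -/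
theorem soloLie_gl6_three_bounds (d₁ q : ℕ) (hq : 1 ≤ q) :
    (d₁ + q + 18 ≤ 36 → d₁ ≤ 17) ∧ (d₁ + q + 19 ≤ 36 → d₁ ≤ 16) ∧ (d₁ + q + 20 ≤ 36 → d₁ ≤ 15) := by
  refine ⟨fun h => by omega, fun h => by omega, fun h => by omega⟩

end Bookkeeping

end Summit.MatrixMultiplication.MatrixMultiplication.Theorems
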